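import Summits.ABC.IUTFork.Conditional.Layer1OfSa
import Summits.ABC.IUTFork.Conditional.Layer1OfSb
import HarnessLib

/-!
# L1 layer certificate — honesty companion: `Layer1ResidualA` / `Layer1ResidualB` are KERNEL-INHABITED

abc-iut cell, branch C «conditional verification abc ⇐ S» (rung LADDER-ABC:A2.C, director-abc (C2) layer certificates), PROOF-ONLY
companion of the CERT-L1 parts `Conditional/Layer1OfSa.lean` (p429833 ✓) and `Conditional/Layer1OfSb.lean` (p429996 ✓) of
abc-iut-L1-d4 g5 (top `Layer1OfS.lean` p430020: `Layer1Residual := Layer1ResidualA ∧ Layer1ResidualB`, the ONE binder the apex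
`Conditional/AbcOfS.lean` would take for layer L1). Seat abc-iut-w6-d080 (block C / W6).

WHAT IT SHOWS (the L1 twin of abc-iut-w6-d071's `layer2Residual_inhabited` in `Conditional/Layer2OfS.lean`): every conjunct of the
L1 residual is an index Prop `N_<node>` of abc-iut-c312-2's kernel DAG (`DAGL1*.lean`), i.e. a conjunction `StatementOf @thm₁ ∧ …`
of the TYPES of landed theorems; each carries a kernel witness in the index — `_holds` for 14 of the 16 conjuncts
(FrdI:Def1.1(i)(ii)(iii), Def1.3(i)(v); FrdII:Def2.1(i)(ii), Def2.2(i)(ii), Def3.1(i)–(v)) and `_part` for the two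
PROPOSITION conjuncts FrdI:Prop2.2(ii)/(iii) (DAG row «not marked discharged»: `N_FrdI_Prop2_2_ii_part`,
`N_FrdI_Prop2_2_iii_part`, DAGL1r). Hence:

* `layer1ResidualA_inhabited : Layer1ResidualA`, `layer1ResidualB_inhabited : Layer1ResidualB` — BY NAME, no new proof;
* `layer1Residual_inhabited_parts : Layer1ResidualA ∧ Layer1ResidualB` (= the top's `Layer1Residual` by `Iff.rfl` once p430020
  builds; stated over the parts so that this file does not wait for the top's olean);
* `layer1ConeA_inhabited`, `layer1ConeB_inhabited`, `layer1Cone_inhabited_parts : Layer1ConeA ∧ Layer1ConeB` — the whole L1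
  slice of the Cor. 3.12 cone, AS INDEXED, holds in the kernel (`layer1ConeA_of` / `layer1ConeB_of` applied to the witnesses);
  the L4 twin is abc-iut-w6-d032's `Conditional/Layer4OfSInhabited.lean` (p430828), the L6 one `Layer6OfSaWitness.lean`.

READING (honest framing, as for L2): «residual» in the CERT-L1 count line (176 = Discharged 88 + r 16 + d_data 67 + findings 4 +
refuted-as-typed 1) is a plan/L1/NODES.md COVERAGE status (printed clauses of those 16 items that the named theorems may not
exhaust; the two `_part` rows especially), NOT an open kernel obligation: the apex's L1 binder `(h1 : Layer1Residual)` is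
dischargeable by `⟨layer1ResidualA_inhabited, layer1ResidualB_inhabited⟩` the minute the top builds, so layer L1 contributes
0 open KERNEL obligations to `abc_of_S` at the index level (inhabited ≠ lead-discharged; whether the apex keeps `h1` visible is the C lead's choice). What is NOT claimed: that print's [FrdI] Prop 2.2 (ii)/(iii) are fully covered by
the landed theorems the index names (that is the L1 lead's NODES call), or anything about [IUTchIII] Cor. 3.12.
No `def`, nothing restated; universe names as in the parts. typed ≠ proved; indexed ≠ endorsed; no side taken.
[claim: Mochizuki2012, status: disputed] (node texts)
-/

namespace Summit.ABC.IUTFork.Conditional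

open Summit.ABC.IUTFork.DAG

universe u₁ u₂ u₃ u₄ u₅ u₆ u₇ u₈ u₉ u₁₀ u₁₁ u₁₂ u₁₃ u₁₄ u₁₅ u₁₆

/-- **The [FrdI] §1–§3 residual of the L1 certificate is kernel-inhabited**: its seven conjuncts are the index Props of
FrdI:Def1.1(i)(ii)(iii), Def1.3(i)(v) (witnesses `_holds`, DAGL1d/DAGL1p) and FrdI:Prop2.2(ii)(iii) (witnesses `_part`, DAGL1r —
DAG rows not marked discharged). BY NAME; proves nothing new. [claim: Mochizuki2012, status: disputed] -/
theorem layer1ResidualA_inhabited : Layer1ResidualA.{u₁, u₂, u₃, u₄, u₅} :=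
  ⟨N_FrdI_Def1_1_i_holds, N_FrdI_Def1_1_ii_holds, N_FrdI_Def1_1_iii_holds, N_FrdI_Def1_3_i_holds,
    N_FrdI_Def1_3_v_holds, N_FrdI_Prop2_2_ii_part, N_FrdI_Prop2_2_iii_part⟩

/-- **The [FrdI] §4–§6 + [FrdII] residual of the L1 certificate is kernel-inhabited**: its nine conjuncts are the index Props of
FrdII:Def2.1(i)(ii), Def2.2(i)(ii), Def3.1(i)–(v), each with a `_holds` witness (DAGL1c/DAGL1f/DAGL1u). BY NAME; proves nothing
new. [claim: Mochizuki2012, status: disputed] -/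
theorem layer1ResidualB_inhabited : Layer1ResidualB.{u₁, u₂} :=
  ⟨N_FrdII_Def2_1_i_holds, N_FrdII_Def2_1_ii_holds, N_FrdII_Def2_2_i_holds, N_FrdII_Def2_2_ii_holds,
    N_FrdII_Def3_1_i_holds, N_FrdII_Def3_1_ii_holds, N_FrdII_Def3_1_iii_holds, N_FrdII_Def3_1_iv_holds,
    N_FrdII_Def3_1_v_holds⟩

/-- **The L1 residual, parts form, is kernel-inhabited**: `Layer1ResidualA ∧ Layer1ResidualB` — by `Iff.rfl` this IS the top's
`Layer1Residual` (`Conditional/Layer1OfS.lean`, p430020) once that module builds, so the apex binder `(h1 : Layer1Residual)` can be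
instantiated by (the two components of) this term. Inhabited ≠ lead-discharged. [claim: Mochizuki2012, status: disputed] -/
theorem layer1Residual_inhabited_parts : Layer1ResidualA.{u₁, u₂, u₃, u₄, u₅} ∧ Layer1ResidualB.{u₁, u₂} :=
  ⟨layer1ResidualA_inhabited, layer1ResidualB_inhabited⟩

/-- **The whole [FrdI] §1–§3 slice of the L1 cone, AS INDEXED, holds in the kernel** (`layer1ConeA_of` at the witness).
[claim: Mochizuki2012, status: disputed] -/
theorem layer1ConeA_inhabited : Layer1ConeA.{u₁, u₂, u₃, u₄, u₅} :=
  layer1ConeA_of layer1ResidualA_inhabited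

/-- **The whole [FrdI] §4–§6 + [FrdII] slice of the L1 cone, AS INDEXED, holds in the kernel** (`layer1ConeB_of` at the witness).
[claim: Mochizuki2012, status: disputed] -/
theorem layer1ConeB_inhabited :
    Layer1ConeB.{u₁, u₂, u₃, u₄, u₅, u₆, u₇, u₈, u₉, u₁₀, u₁₁, u₁₂, u₁₃, u₁₄, u₁₅, u₁₆} :=
  layer1ConeB_of layer1ResidualB_inhabited

/-- **The whole L1 slice of the [IUTchIII] Cor. 3.12 cone, AT THE INDEX LEVEL, is a kernel theorem**: `Layer1ConeA ∧ Layer1ConeB`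
outright (the conclusion of the top's `layer1Cone_of`, reached without its hypothesis). Index level ≠ print coverage; no NODES row
moves; nothing about Cor. 3.12 itself. [claim: Mochizuki2012, status: disputed] -/
theorem layer1Cone_inhabited_parts :
    Layer1ConeA.{u₁, u₂, u₃, u₄, u₅} ∧
      Layer1ConeB.{u₁, u₂, u₃, u₄, u₅, u₆, u₇, u₈, u₉, u₁₀, u₁₁, u₁₂, u₁₃, u₁₄, u₁₅, u₁₆} :=
  ⟨layer1ConeA_inhabited, layer1ConeB_inhabited⟩

end Summit.ABC.IUTFork.Conditional
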